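import Summits.SmoothPoincare4.SmoothPoincare4.Theses.SymplecticOrigami
import Literature.Geometry.Symplectic.OrigamiUnfolding
import Literature.Geometry.Symplectic.OrigamiUnfoldingOfNormalForm
import Literature.Geometry.Symplectic.OrigamiCollarNormalFormProofs
import Literature.Geometry.Symplectic.OrigamiSphereProofs
import Literature.Topology.FourManifolds.HomotopyS4CompactProofs
import Literature.Topology.FourManifolds.HomotopyS4OrientableProofs

/-!
# `SymplecticOrigami.OrigamiUnfolding` (item stmt-SmoothPoincare4-8127) from the unfolding theorem

The route item `OrigamiUnfolding` is the bridge "origami form with connected fold on a homotopy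
4-sphere ⇒ the typed fold data of `OrigamiRung` / `OrigamiFoldExistence`".  Its mathematical content
is the UNFOLDING (symplectic cutting) theorem of Cannas da Silva–Guillemin–Woodward (2000) and
Cannas da Silva–Guillemin–Pires (2010, Prop. 2.8 with Def. 2.13 and the proof of Prop. 2.26) for
compact oriented origami 4-manifolds with connected fold — the tree's named fact
`Literature.Geometry.Symplectic.exists_symplecticCutPieces_of_isOrigamiForm`
(`Literature/Geometry/Symplectic/OrigamiUnfolding.lean`) — together with two packaging facts
about homotopy 4-spheres that the tree PROVES: compactness
(`Literature.Topology.FourManifolds.compactSpace_of_homotopyEquiv_sphere_four_holds`, Hatcher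
Prop. 3.29) and orientability
(`Literature.Topology.FourManifolds.isOrientable_of_homotopyEquiv_sphere_four_holds`, Lee Thm. 15.43).

* `frontier_subset_compl_union` — point-set helper: the frontier of an open set misses it and
  every open set disjoint from it.
* `origamiUnfolding_of_cutPieces` — the item `OrigamiUnfolding` follows from the named fact (pure
  logic plus the two packaging theorems; the frontier of each piece lies in the fold).
  CONDITIONAL on the named fact; unconditional otherwise.
* `cutPieces_hypotheses_sphere` — non-vacuity of the fact's hypotheses: the round `S⁴` with the
  origami form `ω₀|` of Cannas da Silva–Guillemin–Pires Example 2.3 (tree: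
  `isOrigamiForm_sphereOrigamiForm`, fold = the equator) is a compact connected orientable
  4-manifold carrying an origami form with connected fold.
* `origamiUnfolding_proof` — the item `OrigamiUnfolding`, UNCONDITIONALLY (closes
  stmt-SmoothPoincare4-8127): the named fact is discharged in the tree at universe `0` — the
  folded Moser normal form of the fold (`exists_origamiCollarNormalForm_holds`,
  `OrigamiCollarNormalFormProofs.lean`, Cannas da Silva–Guillemin–Woodward 2000 Thm. 1) feeds the
  symplectic-cut / blow-down construction (`exists_symplecticCutPieces_of_normalForm`,
  `OrigamiUnfoldingOfNormalForm.lean`).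
-/

noncomputable section

-- the prescribed namespace `Summit.<P>.<Sub>.…` duplicates `SmoothPoincare4` (P = Sub)
set_option linter.dupNamespace false

open scoped Manifold ContDiff Topology ContinuousMap
open Set TopologicalSpace
open Literature.Geometry.Kaehler (MForm IsSmoothForm IsClosedForm)
open Literature.Geometry.Symplectic
open Literature.Topology.FourManifolds

namespace Summit.SmoothPoincare4.SmoothPoincare4.Theorems.SymplecticOrigami.Unfolding

/-- The frontier of an open set `A` is disjoint from `A` and from every open set `B` disjoint
from `A`; hence it lies in the complement of `A ∪ B`. [folklore] -/
theorem frontier_subset_compl_union {X : Type*} [TopologicalSpace X] {A B : Set X}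
    (hA : IsOpen A) (hB : IsOpen B) (hAB : Disjoint A B) : frontier A ⊆ (A ∪ B)ᶜ := by
  intro x hx
  rw [hA.frontier_eq] at hx
  rintro (h | h)
  · exact hx.2 h
  · exact (hAB.closure_left hB).notMem_of_mem_left hx.1 h

/-- **`OrigamiUnfolding` from the unfolding theorem.** GIVEN the named fact
`Literature.Geometry.Symplectic.exists_symplecticCutPieces_of_isOrigamiForm` (Cannas da
Silva–Guillemin–Pires 2010, Prop. 2.8 / Def. 2.13 / Prop. 2.26), every origami form with connected
fold on a smooth 4-manifold `M ≃ₕ S⁴` carries the fold data of the route: `M` is compact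
(Hatcher Prop. 3.29, tree theorem `compactSpace_of_homotopyEquiv_sphere_four_holds`), connected
(`S⁴` is path connected and `M ≃ₕ S⁴`) and orientable (Lee Thm. 15.43, tree theorem
`isOrientable_of_homotopyEquiv_sphere_four_holds`), so the fact applies; the embedded 3-manifold
onto the fold is the folding hypersurface of `IsOrigamiForm`, and the frontier of each (open)
piece lies in the complement of both pieces, i.e. in the fold, where the fact controls the
blow-down map. [cite: CannasdasilvaGuilleminPires2010, Prop. 2.8 and Prop. 2.26] -/
theorem origamiUnfolding_of_cutPieces (h : exists_symplecticCutPieces_of_isOrigamiForm.{0}) :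
    Summit.SmoothPoincare4.SmoothPoincare4.Theses.SymplecticOrigami.OrigamiUnfolding := by
  intro M _ _ _ _ _ e so hso hconn
  haveI : CompactSpace M := compactSpace_of_homotopyEquiv_sphere_four_holds M e
  haveI := pathConnectedSpace_sphere_four
  haveI : PathConnectedSpace M := pathConnectedSpace_of_homotopyEquiv e
  have hO : IsOrientable (𝓡 4) M := isOrientable_of_homotopyEquiv_sphere_four_holds M e
  obtain ⟨V, N, i1, i2, i3, i4, i5, i6, i7, s, S, j1, j2, j3, j4, j5, b, β, ⟨hdisj, hne, hcompl⟩,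
    hprops⟩ := h M hO so hso hconn
  obtain ⟨Z, tZ, cZ, mZ, _cZ, z, hfold⟩ := hso.exists_isFoldedForm
  have hrange : Set.range z = ((V 0 : Set M) ∪ (V 1 : Set M))ᶜ :=
    hfold.range_eq.trans hcompl.symm
  have hconn' : IsConnected ((V 0 : Set M) ∪ (V 1 : Set M))ᶜ := hcompl ▸ hconn
  have hd : Disjoint (V 0 : Set M) (V 1) := Opens.coe_disjoint.2 hdisj
  have h0 : frontier (V 0 : Set M) ⊆ fold so :=
    hcompl ▸ frontier_subset_compl_union (V 0).isOpen (V 1).isOpen hd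
  have h1 : frontier (V 1 : Set M) ⊆ fold so := by
    rw [← hcompl, Set.union_comm]
    exact frontier_subset_compl_union (V 1).isOpen (V 0).isOpen hd.symm
  have hfront : ∀ i, frontier (V i : Set M) ⊆ fold so := fun i => by
    fin_cases i
    · exact h0
    · exact h1
  refine ⟨V, N, i1, i2, i3, i4, i5, i6, i7, s, S, j1, j2, j3, j4, j5, b, β,
    ⟨hdisj, hne, hconn', hcompl, Z, tZ, cZ, mZ, z, hfold.embedding, hrange⟩, fun i => ?_⟩
  obtain ⟨h1, h2, h3, h4, h5, h6, h7, h8, h9, -, h11, h12⟩ := hprops i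
  exact ⟨h1, h2, h3, h4, h5, h6, h7, h8, h9,
    (Set.image_mono (hfront i)).trans h11.subset, fun x hx => h12 x (hfront i hx)⟩

/-- The equator of the round `S⁴`, the fold of its origami form, is connected (it is the image
of `S³` under the equator inclusion). [cite: CannasdasilvaGuilleminPires2010, Example 2.3] -/
theorem isConnected_fold_sphereOrigamiForm : IsConnected (fold sphereOrigamiForm) := by
  rw [fold_sphereOrigamiForm, ← range_equatorIncl]
  have h3 : IsPathConnected (Metric.sphere (0 : EuclideanSpace ℝ (Fin 4)) 1) := by
    refine isPathConnected_sphere ?_ 0 zero_le_one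
    rw [← Module.finrank_eq_rank, finrank_euclideanSpace_fin]
    exact Nat.one_lt_cast.mpr (by norm_num)
  haveI : PathConnectedSpace (Metric.sphere (0 : EuclideanSpace ℝ (Fin 4)) 1) :=
    isPathConnected_iff_pathConnectedSpace.mp h3
  exact isConnected_range isometry_equatorIncl.continuous

/-- **Non-vacuity of the unfolding fact's hypotheses**: the round `S⁴` is a compact connected
orientable 4-manifold carrying an origami form — `ω₀|_{S⁴}`, Cannas da Silva–Guillemin–Pires
2010, Example 2.3, `isOrigamiForm_sphereOrigamiForm` — whose fold (the equator) is connected; so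
`exists_symplecticCutPieces_of_isOrigamiForm` has an instance to which it applies (its printed
output there is Example 2.6: two copies of `ℂℙ²` with a line as centre).
[cite: CannasdasilvaGuilleminPires2010, Example 2.3 and Example 2.6] -/
theorem cutPieces_hypotheses_sphere :
    CompactSpace (Metric.sphere (0 : EuclideanSpace ℝ (Fin 5)) 1) ∧
    ConnectedSpace (Metric.sphere (0 : EuclideanSpace ℝ (Fin 5)) 1) ∧
    IsOrientable (𝓡 4) (Metric.sphere (0 : EuclideanSpace ℝ (Fin 5)) 1) ∧
    IsOrigamiForm sphereOrigamiForm ∧ IsConnected (fold sphereOrigamiForm) := by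
  haveI := pathConnectedSpace_sphere_four
  exact ⟨inferInstance, inferInstance,
    isOrientable_of_homotopyEquiv_sphere_four_holds _ (ContinuousMap.HomotopyEquiv.refl _),
    isOrigamiForm_sphereOrigamiForm, isConnected_fold_sphereOrigamiForm⟩

/-- **`OrigamiUnfolding` (route `SymplecticOrigami`, item stmt-SmoothPoincare4-8127),
unconditionally**: every origami form with connected fold on a smooth 4-manifold `M ≃ₕ S⁴`
carries the typed fold data of `OrigamiRung` / `OrigamiFoldExistence` — the two sides
`V 0 = M⁺`, `V 1 = M⁻` of the fold, the closed connected symplectic cut pieces `(N i, s i)`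
(Cannas da Silva–Guillemin–Pires 2010, Prop. 2.8), their symplectic centres `b i : S i ↪ N i`
and the blow-down maps `β i` (Def. 2.13, proof of Prop. 2.26).  Composition of the conditional
reduction `origamiUnfolding_of_cutPieces` with the discharged unfolding fact.
[cite: CannasdasilvaGuilleminPires2010, Prop. 2.8 with Def. 2.13 and proof of Prop. 2.26] -/
theorem origamiUnfolding_proof :
    Summit.SmoothPoincare4.SmoothPoincare4.Theses.SymplecticOrigami.OrigamiUnfolding :=
  origamiUnfolding_of_cutPieces
    (exists_symplecticCutPieces_of_normalForm exists_origamiCollarNormalForm_holds)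

end Summit.SmoothPoincare4.SmoothPoincare4.Theorems.SymplecticOrigami.Unfolding

end
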